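import Summits.QuantumFields.YangMills.Theorems.ConvexGribovBodyCovarianceBoundTwistReduction
import HarnessLib

/-!
# `CovarianceBound` split along momentum: `CovarianceBoundZero` (`p = 0`) and `CovarianceBoundPos` (`p ≠ 0`) —
# route-vocabulary children, the glue `covarianceBound_of_subs`, exactness, and the dictionary to the line's vocabulary

Crux `Summit.QuantumFields.YangMills.Theses.ConvexGribovBody.CovarianceBound` (stmt-QuantumFields-8780): the
volume-uniform bound on the minimal-Coulomb-gauge equal-time gluon covariance, every compact simple `G`, every faithful
unitary `r`, `β ≥ β₀`, `S ≥ S₀(β)`, ALL spatial momenta `p` (`p = 0` included).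

This file is the typed DECOMPOSITION prepared by the crux-strategist seats (`Cruxes/CovarianceBound/STRATEGY-CENSUS.md`
§5 D2 and gen-1 §Decomposition; `Cruxes/CovarianceBound/SPLIT-OPTION.md`; written by planner-cstrat-stmt-QuantumFields-8780-s1-0
as `Cruxes/CovarianceBound/ConvexGribovBodyCovarianceBoundSplit.lean`, commit 9b7af699d8a1) and LANDED verbatim by the line lead
prover-line-stmt-QuantumFields-8780-c4-0 (planners cannot write under Theorems/), so that re-targeting the route to
`CovarianceBoundZero` (the piece the line `Sketch` plans: `covarianceBoundZero_of_meanTwistGap_perpZero`, first stub numerically alive,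
`Cruxes/CovarianceBound/NUMERICS-c4.md`) is one `route edit --split` away:

* §1 — the two children IN THE ROUTE FILE'S OWN VOCABULARY (inline `let`s over `wilsonMeasure`, `gaugeTransform`, exactly
  the parent's body with the momentum quantifier restricted), so that `ledger route edit --split CovarianceBound` can file
  them verbatim: `CovarianceBoundZero` (the body at `p = 0`: CLT-order fluctuations of the zero mode `Σ_y A_j(y)` = `L ×`
  the gauge-fixed flux through a transverse plane; the structured corner — torons, centre symmetry, twisted competitors)
  and `CovarianceBoundPos` (the body at every `p ≠ 0`: the transverse gauge-fixed modes, perturbatively `≍ g² L` at the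
  lowest momentum — Gribov–Zwanziger infrared finiteness proper); the glue
  `covarianceBound_of_subs : CovarianceBoundZero → CovarianceBoundPos → CovarianceBound` (pure logic: `β₀ = max`,
  `D = max`, `S₀ = max`, case split on `p = 0`) and the converse `subs_of_covarianceBound`, so the split is EXACT
  (`covarianceBound_iff_subs`).
* §2 — the dictionary to the Theorems vocabulary of the lines (`supCov`, `supLieCosSq`, `supPerpCosSq`, `wilson4`):
  the per-momentum form of the landed moment reduction (`integral_supCov_le_of_modes`, extracted from
  `covarianceBound_of_modeBounds`), the `𝔤^⊥`-pieces `PerpModeBoundZero` / `PerpModeBoundPos`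
  (`perpModeBound_iff_zero_pos`), and the exact equivalences
  `CovarianceBoundZero ↔ LieModeBoundZero ∧ PerpModeBoundZero`, `CovarianceBoundPos ↔ LieModeBoundPos ∧ PerpModeBoundPos`.
  Consequently the landed twist reduction feeds child 1 directly:
  `covarianceBoundZero_of_meanTwistGap_perpZero : MeanTwistGapBound → PerpModeBoundZero → CovarianceBoundZero`, and for
  representations whose skew part lies in `𝔤` (e.g. `SU(2)` fundamental, `supPerpCosSq_eq_zero_of_skew_mem`) both
  `𝔤^⊥`-pieces are void (`perpModeBoundZero_pos_of_skew_mem`-type remark: they hold with any `D > 0` at such `r`; the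
  items quantify over all `r`, so they remain pieces in general).

Everything here is sorry-free and credits nothing by itself: the children and the `𝔤^⊥`-pieces are route-posited OPEN
statements (`def … : Prop`), the theorems are glue / dictionary. After the route-level split is filed, the gate's glue
item `CovarianceBoundZero → CovarianceBoundPos → CovarianceBound` (route namespace) is closed by
`fun h₀ h₁ => covarianceBound_of_subs h₀ h₁` (the route's children are these definitions verbatim, hence definitionally
equal). [folklore]
-/

set_option autoImplicit false

noncomputable section

namespace Summit.QuantumFields.YangMills.Cruxes.CovarianceBound.Split

open scoped BigOperators Topology Manifold Classical MeasureTheory ProbabilityTheory Matrix InnerProductSpace ComplexConjugate ContinuousMap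
open Filter Set Function TopologicalSpace MeasureTheory
open Literature.MathematicalPhysics.QuantumFieldTheory
open Summit.QuantumFields.YangMills.Cruxes.CovarianceBound.SupportWindow
open Summit.QuantumFields.YangMills.Cruxes.CovarianceBound.TwistStiffness

/-! ## §1 The children in route vocabulary, the glue, exactness -/

/-- **Child 1 (`p = 0`)** — route-posited, OPEN: for every compact simple `G` and faithful unitary `r` there is `β₀`
such that for every `β ≥ β₀` there are `D > 0` and `S₀` with: on every torus `(2S+1)⁴`, `S ≥ S₀`, the ZERO-MOMENTUM
equal-time gluon covariance of the minimal lattice Coulomb gauge (the parent's integrand at `p = 0`) is `≤ D`. -/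
def CovarianceBoundZero : Prop :=
  ∀ (G : Type) [Group G] [TopologicalSpace G] [IsTopologicalGroup G] [CompactSpace G] [MeasurableSpace G] [BorelSpace G], Literature.MathematicalPhysics.QuantumFieldTheory.IsCompactSimpleLieGroup G → ∀ r : Literature.MathematicalPhysics.QuantumFieldTheory.LatticeRep G, ∃ β₀ : ℝ, ∀ β : ℝ, β₀ ≤ β → ∃ D : ℝ, 0 < D ∧ ∃ S₀ : ℕ, ∀ S : ℕ, S₀ ≤ S → let μ := Literature.MathematicalPhysics.QuantumFieldTheory.wilsonMeasure (d := 4) (L := 2 * S + 1) r.ρ β; let fro : Matrix (Fin r.N) (Fin r.N) ℂ → ℝ := fun M => ∑ a, ∑ b, ‖M a b‖ ^ 2; let coul : Literature.MathematicalPhysics.QuantumFieldTheory.GaugeConfig 4 (2 * S + 1) G → (Literature.MathematicalPhysics.QuantumFieldTheory.Site 4 (2 * S + 1) → G) → ℝ := fun U h => -∑ e : Literature.MathematicalPhysics.QuantumFieldTheory.Edge 4 (2 * S + 1), (if e.1 0 = 0 ∧ e.2 ≠ 0 then (r.ρ (Literature.MathematicalPhysics.QuantumFieldTheory.gaugeTransform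 h U e)).trace.re else 0); let cov : Literature.MathematicalPhysics.QuantumFieldTheory.GaugeConfig 4 (2 * S + 1) G → (Literature.MathematicalPhysics.QuantumFieldTheory.Site 4 (2 * S + 1) → G) → (Fin 3 → ZMod (2 * S + 1)) → ℝ := fun U h p => (∑ j : Fin 3, fro (∑ y : Fin 3 → ZMod (2 * S + 1), Complex.exp (-(2 * Real.pi * Complex.I * (∑ i : Fin 3, ((p i).val : ℂ) * ((y i).val : ℂ)) / (2 * S + 1 : ℂ))) • ((1 / 2 : ℂ) • (r.ρ (Literature.MathematicalPhysics.QuantumFieldTheory.gaugeTransform h U (Fin.cons (0 : ZMod (2 * S + 1)) y, j.succ)) - (r.ρ (Literature.MathematicalPhysics.QuantumFieldTheory.gaugeTransform h U (Fin.cons (0 : ZMod (2 * S + 1)) y, j.succ)))ᴴ)))) / ((2 * S + 1 : ℝ) ^ 3); ∫ U, (⨆ h : {h : Literature.MathematicalPhysics.QuantumFieldTheory.Site 4 (2 * S + 1) → G // ∀ h', coul U h ≤ coul U h'}, cov U h.1 0) ∂μ ≤ D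

/-- **Child 2 (`p ≠ 0`)** — route-posited, OPEN: the same bound for every NON-ZERO spatial momentum `p` (the transverse
modes of the minimal-Coulomb-gauge field; Gribov–Zwanziger infrared finiteness proper). -/
def CovarianceBoundPos : Prop :=
  ∀ (G : Type) [Group G] [TopologicalSpace G] [IsTopologicalGroup G] [CompactSpace G] [MeasurableSpace G] [BorelSpace G], Literature.MathematicalPhysics.QuantumFieldTheory.IsCompactSimpleLieGroup G → ∀ r : Literature.MathematicalPhysics.QuantumFieldTheory.LatticeRep G, ∃ β₀ : ℝ, ∀ β : ℝ, β₀ ≤ β → ∃ D : ℝ, 0 < D ∧ ∃ S₀ : ℕ, ∀ S : ℕ, S₀ ≤ S → let μ := Literature.MathematicalPhysics.QuantumFieldTheory.wilsonMeasure (d := 4) (L := 2 * S + 1) r.ρ β; let fro : Matrix (Fin r.N) (Fin r.N) ℂ → ℝ := fun M => ∑ a, ∑ b, ‖M a b‖ ^ 2; let coul : Literature.MathematicalPhysics.QuantumFieldTheory.GaugeConfig 4 (2 * S + 1) G → (Literature.MathematicalPhysics.QuantumFieldTheory.Site 4 (2 * S + 1) → G) → ℝ := fun U h => -∑ e : Literature.MathematicalPhysics.QuantumFieldTheory.Edge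 4 (2 * S + 1), (if e.1 0 = 0 ∧ e.2 ≠ 0 then (r.ρ (Literature.MathematicalPhysics.QuantumFieldTheory.gaugeTransform h U e)).trace.re else 0); let cov : Literature.MathematicalPhysics.QuantumFieldTheory.GaugeConfig 4 (2 * S + 1) G → (Literature.MathematicalPhysics.QuantumFieldTheory.Site 4 (2 * S + 1) → G) → (Fin 3 → ZMod (2 * S + 1)) → ℝ := fun U h p => (∑ j : Fin 3, fro (∑ y : Fin 3 → ZMod (2 * S + 1), Complex.exp (-(2 * Real.pi * Complex.I * (∑ i : Fin 3, ((p i).val : ℂ) * ((y i).val : ℂ)) / (2 * S + 1 : ℂ))) • ((1 / 2 : ℂ) • (r.ρ (Literature.MathematicalPhysics.QuantumFieldTheory.gaugeTransform h U (Fin.cons (0 : ZMod (2 * S + 1)) y, j.succ)) - (r.ρ (Literature.MathematicalPhysics.QuantumFieldTheory.gaugeTransform h U (Fin.cons (0 : ZMod (2 * S + 1)) y, j.succ)))ᴴ)))) / ((2 * S + 1 : ℝ) ^ 3); ∀ p : Fin 3 → ZMod (2 * S + 1), p ≠ 0 → ∫ U, (⨆ h : {h : Literature.MathematicalPhysics.QuantumFieldTheory.Site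 4 (2 * S + 1) → G // ∀ h', coul U h ≤ coul U h'}, cov U h.1 p) ∂μ ≤ D

/-- **Glue `C₁ → C₂ → C`** (the closer of the route's glue item): pure logic — `β₀ = max β₁ β₂`, `D = max D₁ D₂`,
`S₀ = max S₁ S₂`, case split on `p = 0`. -/
theorem covarianceBound_of_subs :
    CovarianceBoundZero → CovarianceBoundPos →
      Summit.QuantumFields.YangMills.Theses.ConvexGribovBody.CovarianceBound := by
  intro h0 h1 G _ _ _ _ _ _ hG r
  obtain ⟨β₁, hβ₁⟩ := h0 G hG r
  obtain ⟨β₂, hβ₂⟩ := h1 G hG r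
  refine ⟨max β₁ β₂, fun β hβ => ?_⟩
  obtain ⟨D₁, hD₁, S₁, hS₁⟩ := hβ₁ β (le_trans (le_max_left _ _) hβ)
  obtain ⟨D₂, hD₂, S₂, hS₂⟩ := hβ₂ β (le_trans (le_max_right _ _) hβ)
  refine ⟨max D₁ D₂, lt_max_of_lt_left hD₁, max S₁ S₂, fun S hS => ?_⟩
  intro μ fro coul cov p
  by_cases hp : p = 0
  · subst hp
    exact le_trans (hS₁ S (le_trans (le_max_left _ _) hS)) (le_max_left _ _)
  · exact le_trans (hS₂ S (le_trans (le_max_right _ _) hS) p hp) (le_max_right _ _)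

/-- **Converse** (restriction to `p = 0`, resp. `p ≠ 0`, same constants). -/
theorem subs_of_covarianceBound :
    Summit.QuantumFields.YangMills.Theses.ConvexGribovBody.CovarianceBound →
      CovarianceBoundZero ∧ CovarianceBoundPos := by
  intro h
  refine ⟨fun G _ _ _ _ _ _ hG r => ?_, fun G _ _ _ _ _ _ hG r => ?_⟩
  · obtain ⟨β₀, hβ₀⟩ := h G hG r
    refine ⟨β₀, fun β hβ => ?_⟩
    obtain ⟨D, hD, S₀, hS₀⟩ := hβ₀ β hβ
    exact ⟨D, hD, S₀, fun S hS => hS₀ S hS 0⟩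
  · obtain ⟨β₀, hβ₀⟩ := h G hG r
    refine ⟨β₀, fun β hβ => ?_⟩
    obtain ⟨D, hD, S₀, hS₀⟩ := hβ₀ β hβ
    exact ⟨D, hD, S₀, fun S hS p _ => hS₀ S hS p⟩

/-- **Exactness**: the momentum split is a decomposition of the crux, not a weakening. -/
theorem covarianceBound_iff_subs :
    Summit.QuantumFields.YangMills.Theses.ConvexGribovBody.CovarianceBound ↔
      CovarianceBoundZero ∧ CovarianceBoundPos :=
  ⟨subs_of_covarianceBound, fun h => covarianceBound_of_subs h.1 h.2⟩

/-! ## §2 Dictionary to the Theorems vocabulary (`supCov`, `supLieCosSq`, `supPerpCosSq`, `wilson4`) -/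

/-- Child 1 over the named vocabulary (definitional, as `covarianceBound_iff`). -/
theorem covarianceBoundZero_iff :
    CovarianceBoundZero ↔
      ∀ (G : Type) [Group G] [TopologicalSpace G] [IsTopologicalGroup G] [CompactSpace G]
        [MeasurableSpace G] [BorelSpace G], IsCompactSimpleLieGroup G →
        ∀ r : LatticeRep G, ∃ β₀ : ℝ, ∀ β : ℝ, β₀ ≤ β → ∃ D : ℝ, 0 < D ∧ ∃ S₀ : ℕ, ∀ S : ℕ,
          S₀ ≤ S → ∫ U, supCov r S 0 U ∂(wilson4 r β S) ≤ D :=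
  Iff.rfl

/-- Child 2 over the named vocabulary (definitional). -/
theorem covarianceBoundPos_iff :
    CovarianceBoundPos ↔
      ∀ (G : Type) [Group G] [TopologicalSpace G] [IsTopologicalGroup G] [CompactSpace G]
        [MeasurableSpace G] [BorelSpace G], IsCompactSimpleLieGroup G →
        ∀ r : LatticeRep G, ∃ β₀ : ℝ, ∀ β : ℝ, β₀ ≤ β → ∃ D : ℝ, 0 < D ∧ ∃ S₀ : ℕ, ∀ S : ℕ,
          S₀ ≤ S → ∀ p : Fin 3 → ZMod (2 * S + 1), p ≠ 0 → ∫ U, supCov r S p U ∂(wilson4 r β S) ≤ D :=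
  Iff.rfl

/-- **`𝔤^⊥`-piece at `p = 0`** (route-posited, OPEN in general; void when `½(ρg − (ρg)ᴴ) ∈ 𝔤` for all `g`):
`∫ sup_h ‖P_⊥ Ĉ_j(0)‖²_F dμ_β ≤ D (2S+1)³` — CLT-order fluctuations of the zero mode of the `𝔤^⊥`-part (for `SU(N ≥ 3)`
fundamental: of the C-odd composite `Im tr ρ(U^h)`) in the argmin frame. -/
def PerpModeBoundZero : Prop :=
  ∀ (G : Type) [Group G] [TopologicalSpace G] [IsTopologicalGroup G] [CompactSpace G]
    [MeasurableSpace G] [BorelSpace G], IsCompactSimpleLieGroup G → ∀ r : LatticeRep G,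
    ∃ β₀ : ℝ, ∀ β : ℝ, β₀ ≤ β → ∃ D : ℝ, 0 < D ∧ ∃ S₀ : ℕ, ∀ S : ℕ, S₀ ≤ S →
      ∀ j : Fin 3, ∫ U, supPerpCosSq r S 0 j U ∂(wilson4 r β S) ≤ D * (2 * S + 1 : ℝ) ^ 3

/-- **`𝔤^⊥`-piece at `p ≠ 0`** (route-posited, OPEN in general; void as above). -/
def PerpModeBoundPos : Prop :=
  ∀ (G : Type) [Group G] [TopologicalSpace G] [IsTopologicalGroup G] [CompactSpace G]
    [MeasurableSpace G] [BorelSpace G], IsCompactSimpleLieGroup G → ∀ r : LatticeRep G,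
    ∃ β₀ : ℝ, ∀ β : ℝ, β₀ ≤ β → ∃ D : ℝ, 0 < D ∧ ∃ S₀ : ℕ, ∀ S : ℕ, S₀ ≤ S →
      ∀ (p : Fin 3 → ZMod (2 * S + 1)) (j : Fin 3), p ≠ 0 →
        ∫ U, supPerpCosSq r S p j U ∂(wilson4 r β S) ≤ D * (2 * S + 1 : ℝ) ^ 3

/-- `PerpModeBound` is exactly its two momentum pieces (`β₀ = max`, `S₀ = max`, `D = D₁ + D₂`). -/
theorem perpModeBound_iff_zero_pos : PerpModeBound ↔ PerpModeBoundZero ∧ PerpModeBoundPos := by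
  constructor
  · intro h
    refine ⟨fun G _ _ _ _ _ _ hG r => ?_, fun G _ _ _ _ _ _ hG r => ?_⟩
    · obtain ⟨β₀, hβ₀⟩ := h G hG r
      refine ⟨β₀, fun β hβ => ?_⟩
      obtain ⟨D, hD, S₀, hS₀⟩ := hβ₀ β hβ
      exact ⟨D, hD, S₀, fun S hS j => hS₀ S hS 0 j⟩
    · obtain ⟨β₀, hβ₀⟩ := h G hG r
      refine ⟨β₀, fun β hβ => ?_⟩
      obtain ⟨D, hD, S₀, hS₀⟩ := hβ₀ β hβ
      exact ⟨D, hD, S₀, fun S hS p j _ => hS₀ S hS p j⟩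
  · rintro ⟨h0, h1⟩ G _ _ _ _ _ _ hG r
    obtain ⟨β₁, hβ₁⟩ := h0 G hG r
    obtain ⟨β₂, hβ₂⟩ := h1 G hG r
    refine ⟨max β₁ β₂, fun β hβ => ?_⟩
    obtain ⟨D₁, hD₁, S₁, hS₁⟩ := hβ₁ β (le_trans (le_max_left _ _) hβ)
    obtain ⟨D₂, hD₂, S₂, hS₂⟩ := hβ₂ β (le_trans (le_max_right _ _) hβ)
    refine ⟨D₁ + D₂, by positivity, max S₁ S₂, fun S hS p j => ?_⟩
    have hL : (0 : ℝ) ≤ (2 * S + 1 : ℝ) ^ 3 := by positivity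
    by_cases hp : p = 0
    · subst hp
      calc ∫ U, supPerpCosSq r S 0 j U ∂(wilson4 r β S) ≤ D₁ * (2 * S + 1 : ℝ) ^ 3 :=
            hS₁ S (le_trans (le_max_left _ _) hS) j
        _ ≤ (D₁ + D₂) * (2 * S + 1 : ℝ) ^ 3 := mul_le_mul_of_nonneg_right (by linarith) hL
    · calc ∫ U, supPerpCosSq r S p j U ∂(wilson4 r β S) ≤ D₂ * (2 * S + 1 : ℝ) ^ 3 :=
            hS₂ S (le_trans (le_max_right _ _) hS) p j hp
        _ ≤ (D₁ + D₂) * (2 * S + 1 : ℝ) ^ 3 := mul_le_mul_of_nonneg_right (by linarith) hL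

/-- **Per-momentum moment reduction** (the body of the landed `covarianceBound_of_modeBounds` at one `(β, S, p)`): if
at momentum `p` every polarisation has `∫ sup‖P_𝔤 Ĉ_j‖² ≤ D₁ L³` and `∫ sup‖P_⊥ Ĉ_j‖² ≤ D₂ L³`, then
`∫ sup cov(·, p) ≤ 15 (D₁ + D₂)` — mode reduction, `∫ sup‖Ŝ_j‖² ≤ 4 ∫ sup‖Ĉ_j‖²`, orthogonal split, `L³` cancels. -/
theorem integral_supCov_le_of_modes {G : Type} [Group G] [TopologicalSpace G] [IsTopologicalGroup G]
    [CompactSpace G] [MeasurableSpace G] [BorelSpace G] (r : LatticeRep G) (β : ℝ) (S : ℕ)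
    (p : Fin 3 → ZMod (2 * S + 1)) {D₁ D₂ : ℝ}
    (hLie' : ∀ j : Fin 3, ∫ U, supLieCosSq r S p j U ∂(wilson4 r β S) ≤ D₁ * (2 * S + 1 : ℝ) ^ 3)
    (hPerp' : ∀ j : Fin 3, ∫ U, supPerpCosSq r S p j U ∂(wilson4 r β S) ≤ D₂ * (2 * S + 1 : ℝ) ^ 3) :
    ∫ U, supCov r S p U ∂(wilson4 r β S) ≤ 15 * (D₁ + D₂) := by
  have hmeas := stub_supMeasurable
  have hsin := stub_sinLeCos
  have hred := stub_modeReduction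
  have hsplit := stub_projSplit
  have hL3 : (0 : ℝ) < (2 * S + 1 : ℝ) ^ 3 := by positivity
  -- landed stub: minimisers, bounds, measurability
  have hM := fun j => hmeas G r S p j
  have hex : ∀ U : GaugeConfig 4 (2 * S + 1) G, ∃ h, IsCoulMin r S U h := (hM 0).1
  have hbounds : ∀ (j : Fin 3) (U : GaugeConfig 4 (2 * S + 1) G) (h : Site 4 (2 * S + 1) → G),
      (0 ≤ modeCov r S U h p ∧ modeCov r S U h p ≤ 3 * r.N * (2 * S + 1 : ℝ) ^ 3) ∧
      froSq (cosMode r S p j U h) ≤ r.N * (2 * S + 1 : ℝ) ^ 6 ∧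
      froSq (sinMode r S p j U h) ≤ r.N * (2 * S + 1 : ℝ) ^ 6 := fun j => (hM j).2.1
  have hmC : Measurable (supCov r S p) := (hM 0).2.2.1
  have hmCos : ∀ j, Measurable (supCosSq r S p j) := fun j => (hM j).2.2.2.1
  have hmSin : ∀ j, Measurable (supSinSq r S p j) := fun j => (hM j).2.2.2.2.1
  have hsupb := fun j => (hM j).2.2.2.2.2
  have hcosb : ∀ (j : Fin 3) (U : GaugeConfig 4 (2 * S + 1) G) (h : Site 4 (2 * S + 1) → G),
      IsCoulMin r S U h → froSq (cosMode r S p j U h) ≤ r.N * (2 * S + 1 : ℝ) ^ 6 :=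
    fun j U h _ => (hbounds j U h).2.1
  -- landed stub: mode reduction (A), (B)
  obtain ⟨hred1, hred0, -⟩ := hred G r β S p hex hbounds hmC hmCos hmSin
  -- landed stub: sine ≤ 4 cosine
  have hsc : ∀ j : Fin 3, ∫ U, supSinSq r S p j U ∂(wilson4 r β S) ≤
      4 * ∫ U, supCosSq r S p j U ∂(wilson4 r β S) := by
    intro j
    by_cases hp : p = 0
    · have h0 : (fun U => supSinSq r S p j U) = fun _ => (0 : ℝ) := funext fun U => hred0 hp j U
      have hnn : 0 ≤ ∫ U, supCosSq r S p j U ∂(wilson4 r β S) :=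
        integral_nonneg fun U => ((hsupb j) U).2.1.1
      calc ∫ U, supSinSq r S p j U ∂(wilson4 r β S) = 0 := by rw [h0]; simp
        _ ≤ 4 * ∫ U, supCosSq r S p j U ∂(wilson4 r β S) := by linarith
    · exact hsin G r β S p j hp hex (fun U h => ⟨(hbounds j U h).2.1, (hbounds j U h).2.2⟩)
        (hmCos j) (hmSin j)
  -- landed stub: projected split, integrated, fed with the two moment hypotheses
  have hcosj : ∀ j : Fin 3, ∫ U, supCosSq r S p j U ∂(wilson4 r β S) ≤
      D₁ * (2 * S + 1 : ℝ) ^ 3 + D₂ * (2 * S + 1 : ℝ) ^ 3 := by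
    intro j
    have hPj := hsplit G r S p j
    have hle : ∀ U, supCosSq r S p j U ≤ supLieCosSq r S p j U + supPerpCosSq r S p j U :=
      fun U => ((hPj.2.2.2 U (hcosb j U))).2.2.2.2
    have hbL : ∀ U, 0 ≤ supLieCosSq r S p j U ∧ supLieCosSq r S p j U ≤ r.N * (2 * S + 1 : ℝ) ^ 6 :=
      fun U => ⟨(hPj.2.2.2 U (hcosb j U)).1, (hPj.2.2.2 U (hcosb j U)).2.1⟩
    have hbP : ∀ U, 0 ≤ supPerpCosSq r S p j U ∧ supPerpCosSq r S p j U ≤ r.N * (2 * S + 1 : ℝ) ^ 6 :=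
      fun U => ⟨(hPj.2.2.2 U (hcosb j U)).2.2.1, (hPj.2.2.2 U (hcosb j U)).2.2.2.1⟩
    have hintL : Integrable (supLieCosSq r S p j) (wilson4 r β S) := by
      refine Integrable.of_bound (hPj.2.1).aestronglyMeasurable (r.N * (2 * S + 1 : ℝ) ^ 6) ?_
      exact Filter.Eventually.of_forall fun U => by
        rw [Real.norm_eq_abs, abs_of_nonneg (hbL U).1]; exact (hbL U).2
    have hintP : Integrable (supPerpCosSq r S p j) (wilson4 r β S) := by
      refine Integrable.of_bound (hPj.2.2.1).aestronglyMeasurable (r.N * (2 * S + 1 : ℝ) ^ 6) ?_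
      exact Filter.Eventually.of_forall fun U => by
        rw [Real.norm_eq_abs, abs_of_nonneg (hbP U).1]; exact (hbP U).2
    have hintC : Integrable (supCosSq r S p j) (wilson4 r β S) := by
      refine Integrable.of_bound (hmCos j).aestronglyMeasurable (r.N * (2 * S + 1 : ℝ) ^ 6) ?_
      exact Filter.Eventually.of_forall fun U => by
        rw [Real.norm_eq_abs, abs_of_nonneg ((hsupb j) U).2.1.1]; exact ((hsupb j) U).2.1.2
    have hstep : ∫ U, supCosSq r S p j U ∂(wilson4 r β S) ≤
        (∫ U, supLieCosSq r S p j U ∂(wilson4 r β S)) + ∫ U, supPerpCosSq r S p j U ∂(wilson4 r β S) := by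
      rw [← integral_add hintL hintP]
      exact integral_mono hintC (hintL.add hintP) hle
    linarith [hLie' j, hPerp' j]
  have hjsum : ∀ j : Fin 3, (∫ U, supCosSq r S p j U ∂(wilson4 r β S)) +
      ∫ U, supSinSq r S p j U ∂(wilson4 r β S) ≤
      5 * (D₁ * (2 * S + 1 : ℝ) ^ 3 + D₂ * (2 * S + 1 : ℝ) ^ 3) := by
    intro j
    have h1 := hsc j
    have h2 := hcosj j
    have hnn : 0 ≤ ∫ U, supCosSq r S p j U ∂(wilson4 r β S) :=
      integral_nonneg fun U => ((hsupb j) U).2.1.1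
    nlinarith
  have htot : ∫ U, supCov r S p U ∂(wilson4 r β S) ≤
      (1 / (2 * S + 1 : ℝ) ^ 3) * (3 * (5 * (D₁ * (2 * S + 1 : ℝ) ^ 3 + D₂ * (2 * S + 1 : ℝ) ^ 3))) := by
    refine hred1.trans ?_
    refine mul_le_mul_of_nonneg_left ?_ (by positivity)
    calc ∑ j : Fin 3, ((∫ U, supCosSq r S p j U ∂(wilson4 r β S)) +
          ∫ U, supSinSq r S p j U ∂(wilson4 r β S))
        ≤ ∑ j : Fin 3, 5 * (D₁ * (2 * S + 1 : ℝ) ^ 3 + D₂ * (2 * S + 1 : ℝ) ^ 3) :=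
          Finset.sum_le_sum fun j _ => hjsum j
      _ = 3 * (5 * (D₁ * (2 * S + 1 : ℝ) ^ 3 + D₂ * (2 * S + 1 : ℝ) ^ 3)) := by
          simp only [Finset.sum_const, Finset.card_univ, Fintype.card_fin]
          ring
  have hkey : (1 / (2 * S + 1 : ℝ) ^ 3) * (3 * (5 * (D₁ * (2 * S + 1 : ℝ) ^ 3 + D₂ * (2 * S + 1 : ℝ) ^ 3))) =
      15 * (D₁ + D₂) := by
    field_simp
    ring
  linarith [hkey, htot]

/-- **Child 1 from its `𝔤`- and `𝔤^⊥`-pieces** (`β₀ = max`, `S₀ = max`, `D = 15 (D₁ + D₂)`). -/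
theorem covarianceBoundZero_of_lie_perp : LieModeBoundZero → PerpModeBoundZero → CovarianceBoundZero := by
  intro hLie hPerp
  rw [covarianceBoundZero_iff]
  intro G _ _ _ _ _ _ hG r
  obtain ⟨β₁, hβ₁⟩ := hLie G hG r
  obtain ⟨β₂, hβ₂⟩ := hPerp G hG r
  refine ⟨max β₁ β₂, fun β hβ => ?_⟩
  obtain ⟨D₁, hD₁, S₁, hS₁⟩ := hβ₁ β (le_trans (le_max_left _ _) hβ)
  obtain ⟨D₂, hD₂, S₂, hS₂⟩ := hβ₂ β (le_trans (le_max_right _ _) hβ)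
  refine ⟨15 * (D₁ + D₂), by positivity, max S₁ S₂, fun S hS => ?_⟩
  exact integral_supCov_le_of_modes r β S 0
    (fun j => hS₁ S (le_trans (le_max_left _ _) hS) j)
    (fun j => hS₂ S (le_trans (le_max_right _ _) hS) j)

/-- **Child 2 from its `𝔤`- and `𝔤^⊥`-pieces** (`β₀ = max`, `S₀ = max`, `D = 15 (D₁ + D₂)`). -/
theorem covarianceBoundPos_of_lie_perp : LieModeBoundPos → PerpModeBoundPos → CovarianceBoundPos := by
  intro hLie hPerp
  rw [covarianceBoundPos_iff]
  intro G _ _ _ _ _ _ hG r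
  obtain ⟨β₁, hβ₁⟩ := hLie G hG r
  obtain ⟨β₂, hβ₂⟩ := hPerp G hG r
  refine ⟨max β₁ β₂, fun β hβ => ?_⟩
  obtain ⟨D₁, hD₁, S₁, hS₁⟩ := hβ₁ β (le_trans (le_max_left _ _) hβ)
  obtain ⟨D₂, hD₂, S₂, hS₂⟩ := hβ₂ β (le_trans (le_max_right _ _) hβ)
  refine ⟨15 * (D₁ + D₂), by positivity, max S₁ S₂, fun S hS p hp => ?_⟩
  exact integral_supCov_le_of_modes r β S p
    (fun j => hS₁ S (le_trans (le_max_left _ _) hS) p j hp)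
    (fun j => hS₂ S (le_trans (le_max_right _ _) hS) p j hp)

/-- **Converse for child 1**: the `p = 0` body gives both of its pieces (same constants; pointwise domination
`sup‖P_𝔤 Ĉ_j‖², sup‖P_⊥ Ĉ_j‖² ≤ L³ sup cov`, landed `integral_supLie_supPerp_le`). -/
theorem lie_perp_of_covarianceBoundZero : CovarianceBoundZero → LieModeBoundZero ∧ PerpModeBoundZero := by
  intro h
  rw [covarianceBoundZero_iff] at h
  refine ⟨fun G _ _ _ _ _ _ hG r => ?_, fun G _ _ _ _ _ _ hG r => ?_⟩
  · obtain ⟨β₀, hβ₀⟩ := h G hG r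
    refine ⟨β₀, fun β hβ => ?_⟩
    obtain ⟨D, hD, S₀, hS₀⟩ := hβ₀ β hβ
    exact ⟨D, hD, S₀, fun S hS j => (integral_supLie_supPerp_le r β S 0 j (hS₀ S hS)).1⟩
  · obtain ⟨β₀, hβ₀⟩ := h G hG r
    refine ⟨β₀, fun β hβ => ?_⟩
    obtain ⟨D, hD, S₀, hS₀⟩ := hβ₀ β hβ
    exact ⟨D, hD, S₀, fun S hS j => (integral_supLie_supPerp_le r β S 0 j (hS₀ S hS)).2⟩

/-- **Converse for child 2**. -/
theorem lie_perp_of_covarianceBoundPos : CovarianceBoundPos → LieModeBoundPos ∧ PerpModeBoundPos := by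
  intro h
  rw [covarianceBoundPos_iff] at h
  refine ⟨fun G _ _ _ _ _ _ hG r => ?_, fun G _ _ _ _ _ _ hG r => ?_⟩
  · obtain ⟨β₀, hβ₀⟩ := h G hG r
    refine ⟨β₀, fun β hβ => ?_⟩
    obtain ⟨D, hD, S₀, hS₀⟩ := hβ₀ β hβ
    exact ⟨D, hD, S₀, fun S hS p j hp => (integral_supLie_supPerp_le r β S p j (hS₀ S hS p hp)).1⟩
  · obtain ⟨β₀, hβ₀⟩ := h G hG r
    refine ⟨β₀, fun β hβ => ?_⟩
    obtain ⟨D, hD, S₀, hS₀⟩ := hβ₀ β hβ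
    exact ⟨D, hD, S₀, fun S hS p j hp => (integral_supLie_supPerp_le r β S p j (hS₀ S hS p hp)).2⟩

/-- **Child 1 is exactly `LieModeBoundZero ∧ PerpModeBoundZero`.** -/
theorem covarianceBoundZero_iff_lie_perp : CovarianceBoundZero ↔ LieModeBoundZero ∧ PerpModeBoundZero :=
  ⟨lie_perp_of_covarianceBoundZero, fun h => covarianceBoundZero_of_lie_perp h.1 h.2⟩

/-- **Child 2 is exactly `LieModeBoundPos ∧ PerpModeBoundPos`.** -/
theorem covarianceBoundPos_iff_lie_perp : CovarianceBoundPos ↔ LieModeBoundPos ∧ PerpModeBoundPos :=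
  ⟨lie_perp_of_covarianceBoundPos, fun h => covarianceBoundPos_of_lie_perp h.1 h.2⟩

/-- **The line `Sketch` (twist stiffness) feeds child 1 directly**: the landed reduction
`lieModeBoundZero_of_meanTwistGapBound` (cone inequality + `lieProj` control + measurability) and the `𝔤^⊥`-piece at
`p = 0` give `CovarianceBoundZero`. -/
theorem covarianceBoundZero_of_meanTwistGap_perpZero :
    MeanTwistGapBound → PerpModeBoundZero → CovarianceBoundZero :=
  fun hT hP => covarianceBoundZero_of_lie_perp (lieModeBoundZero_of_meanTwistGapBound hT) hP

/-- **The finer trichotomy recovered**: with child 2 and the two `p = 0` pieces the crux follows (consistency check with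
the landed `covarianceBound_of_zero_pos_perp`). -/
theorem covarianceBound_of_zeroPieces_pos :
    LieModeBoundZero → PerpModeBoundZero → CovarianceBoundPos →
      Summit.QuantumFields.YangMills.Theses.ConvexGribovBody.CovarianceBound :=
  fun h0 h0' h1 => covarianceBound_of_subs (covarianceBoundZero_of_lie_perp h0 h0') h1

end Summit.QuantumFields.YangMills.Cruxes.CovarianceBound.Split

end
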